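import Literature.Geometry.Symplectic.SphereIntersectionIndexHomologicalNoncompact
import Summits.SmoothPoincare4.SmoothPoincare4.Theorems.SymplecticOrigamiGromovRecognitionRelEndGluedBasics
import Mathlib.Analysis.Convex.Contractible

/-!
# The indices of the zeros of a smooth function on the Riemann sphere sum to zero
(registered helper `helper_sphereFunctionIndexSum` of line `cross-cap-laurent`, crux
`GromovRecognitionRelEnd`, item stmt-SmoothPoincare4-11009; it serves the birth stub
`stub_normalVelocityDichotomy` of the Hofer–Lizan–Sikorav local foliation fact, child item
stmt-SmoothPoincare4-16778: the normal velocity of a family of `J`-spheres through an embedded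
sphere with trivial normal bundle is a smooth complex-valued function on `S² = ℂ ∪ {∞}`, and the
present lemma is the global topological input "total index of its zeros `= 0`", Wendl 2018,
proof of Prop. 2.53)

Setting.  A smooth function on the Riemann sphere `S² = ℂ ∪ {∞}` is given by its two chart
readings `h₀ h₁ : ℂ → ℂ` (charts `z` and `w = 1/z`), smooth over `ℝ`, with `h₁ w = h₀ w⁻¹` for
`w ≠ 0`.  Suppose the zero set `{h₀ = 0}` is finite (then the only possible further zero is
`w = 0`, i.e. `z = ∞`).  The local index of a zero `z` is the winding number
`Literature.Topology.PlaneTopology.wind` of `h₀` along the small circle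
`Literature.Topology.PlaneTopology.circleLoop z r` (and of `h₁` along `circleLoop 0 r` for the
zero at infinity).

Claim (`helper_sphereFunctionIndexSum`).  For all sufficiently small radii `r` the indices add up
to zero:  `∑_{h₀ z = 0} wind (h₀ ∘ circleLoop z r) + ∑_{w = 0, h₁ w = 0} wind (h₁ ∘ circleLoop w r) = 0`.
This is Poincaré–Hopf for a section of the trivial line bundle over `S²` (Bredon 1993, VI.12), or,
as proved here, the vanishing of the class of a `2`-sphere in `H₂(ℝ⁴; ℤ) = 0`.

Proof.  Embed the situation in `X = ℝ⁴ = EuclideanSpace ℝ (Fin 4)` (a manifold over itself):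
`ι c := (0, 0, re c, im c)`, normal coordinate `π y := y₂ + i y₃`, so `π ∘ ι = id`, `π` is smooth
(real-linear) and its zero set (a `2`-plane) is closed.  The two-chart sphere `u := ι ∘ h₀`,
`v := ι ∘ h₁` is smooth with `v z = u z⁻¹`, and glues to a continuous `F : ℂℙ¹ → X`
(`helper_gluedExists`).  By the non-compact homological index theorem of the tree,
`Literature.Geometry.Symplectic.sphere_zeroSetIndex_factorsThroughHomology_of_isClosed`
(Bredon 1993, VI.11 Thm. 11.9), there is an additive `c : H₂(X; ℤ) → ℤ` with
`c (F_*[ℂℙ¹]) = ∑_{π (u z) = 0} wind (π ∘ u ∘ circleLoop z r) + ∑_{w = 0, π (v w) = 0} wind (π ∘ v ∘ circleLoop w r)`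
for all small `r`; the right-hand side is the sum in the claim (`π ∘ u = h₀`, `π ∘ v = h₁`), and the
left-hand side vanishes because `X = ℝ⁴` is contractible, so `F` is null-homotopic and
`F_* = 0` on `H₂` (homotopy invariance, and `H₂(pt) = 0`; Hatcher 2002, Thm. 2.10, Prop. 2.8).

References: G. E. Bredon, *Topology and Geometry*, GTM 139 (1993), VI.11–VI.12; A. Hatcher,
*Algebraic Topology* (2002), Thm. 2.10, Prop. 2.8; C. Wendl, *Holomorphic Curves in Low
Dimensions* (2018), Prop. 2.53.  No new definitions, notation or instances.
-/

noncomputable section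

open scoped Manifold ContDiff Topology
open Set Function
open Literature.Topology.FourManifolds Literature.Topology.FourManifolds.ComplexProjectiveSpace
  Literature.AlgebraicTopology.SingularHomology Literature.Topology.PlaneTopology
  Literature.Geometry.Symplectic

-- the prescribed namespace `Summit.<P>.<Sub>.…` duplicates `SmoothPoincare4` (P = Sub)
set_option linter.dupNamespace false

namespace Summit.SmoothPoincare4.SmoothPoincare4.Theorems.GromovRecognitionRelEnd.CrossCapLaurent

namespace SphereFunctionIndexSum

/-- A continuous map into a contractible space induces the zero map on singular homology in every
positive degree: it is null-homotopic (the identity of the target is), homotopic maps induce the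
same map (Hatcher 2002, Thm. 2.10), and a constant map factors through a point, whose homology
vanishes in positive degrees (Hatcher 2002, Prop. 2.8). [cite: Hatcher2002, Thm. 2.10 and Prop. 2.8] -/
theorem singularHomology_map_eq_zero_of_contractibleSpace {Y X : Type} [TopologicalSpace Y]
    [TopologicalSpace X] [ContractibleSpace X] (F : C(Y, X)) {n : ℕ} (hn : n ≠ 0) :
    singularHomology.map ℤ ℤ F n = 0 := by
  obtain ⟨x₀, hF⟩ : F.Nullhomotopic := by
    simpa only [ContinuousMap.id_comp] using (id_nullhomotopic X).comp_left F
  rw [singularHomology.map_eq_of_homotopic ℤ ℤ hF n]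
  have hfac : ContinuousMap.const Y x₀ =
      (ContinuousMap.const PUnit.{1} x₀).comp (ContinuousMap.const Y PUnit.unit) := by
    ext
    rfl
  rw [hfac, singularHomology.map_comp,
    (isZero_singularHomology_of_subsingleton ℤ ℤ (X := PUnit.{1}) hn).eq_of_src
      (singularHomology.map ℤ ℤ (ContinuousMap.const PUnit.{1} x₀) n) 0,
    CategoryTheory.Limits.comp_zero]

/-- The embedding `c ↦ (0, 0, re c, im c)` of the fibre `ℂ` into `ℝ⁴` is smooth (it is
real-linear; componentwise: constants, `re`, `im`). [folklore] -/
theorem contDiff_fibreEmbedding :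
    ContDiff ℝ ∞ fun c : ℂ => (!₂[(0 : ℝ), 0, c.re, c.im] : EuclideanSpace ℝ (Fin 4)) := by
  rw [contDiff_euclidean]
  intro i
  fin_cases i
  · exact contDiff_const
  · exact contDiff_const
  · exact Complex.reCLM.contDiff
  · exact Complex.imCLM.contDiff

/-- The normal coordinate `y ↦ y₂ + i y₃` on `ℝ⁴` is smooth (it is real-linear: the composite of
two coordinate projections with the identification `ℝ × ℝ ≃ ℂ`). [folklore] -/
theorem contDiff_normalCoordinate :
    ContDiff ℝ ∞ fun y : EuclideanSpace ℝ (Fin 4) => (⟨y 2, y 3⟩ : ℂ) := by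
  have h2 : ContDiff ℝ ∞ fun y : EuclideanSpace ℝ (Fin 4) => y 2 :=
    (EuclideanSpace.proj (𝕜 := ℝ) (2 : Fin 4)).contDiff
  have h3 : ContDiff ℝ ∞ fun y : EuclideanSpace ℝ (Fin 4) => y 3 :=
    (EuclideanSpace.proj (𝕜 := ℝ) (3 : Fin 4)).contDiff
  convert Complex.equivRealProdCLM.symm.contDiff.comp (h2.prodMk h3) using 1
  funext y
  apply Complex.ext <;> simp

end SphereFunctionIndexSum

open SphereFunctionIndexSum

/-- **The indices of the zeros of a smooth function on the Riemann sphere sum to zero**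
(registered stub `helper_sphereFunctionIndexSum` of line `cross-cap-laurent`, signature verbatim).
For `h₀ h₁ : ℂ → ℂ` smooth with `h₁ w = h₀ w⁻¹` (`w ≠ 0`) — the two chart readings of a smooth
function on `S² = ℂ ∪ {∞}` — and `{h₀ = 0}` finite, for all small radii `r` the sum of the winding
numbers of `h₀` about its zeros plus that of `h₁` about `0` (if `h₁ 0 = 0`) vanishes.  Proof: embed
in `ℝ⁴` by `ι c = (0, 0, re c, im c)` with normal coordinate `π y = y₂ + i y₃`; the glued sphere of
`(ι ∘ h₀, ι ∘ h₁)` has zero class in `H₂(ℝ⁴; ℤ)` (`ℝ⁴` is contractible), and by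
`sphere_zeroSetIndex_factorsThroughHomology_of_isClosed` (Bredon 1993, VI.11 Thm. 11.9) an additive
functional of that class equals the sum of the indices. [cite: Bredon1993, VI.11 Thm. 11.9 and VI.12] -/
theorem helper_sphereFunctionIndexSum : ∀ (h₀ h₁ : ℂ → ℂ), ContDiff ℝ ∞ h₀ → ContDiff ℝ ∞ h₁ → (∀ w : ℂ, w ≠ 0 → h₁ w = h₀ w⁻¹) → {z : ℂ | h₀ z = 0}.Finite → ∃ r₀ : ℝ, 0 < r₀ ∧ ∀ r : ℝ, 0 < r → r ≤ r₀ → (∑ᶠ z ∈ {z : ℂ | h₀ z = 0}, Literature.Topology.PlaneTopology.wind (fun t => h₀ (Literature.Topology.PlaneTopology.circleLoop z r t))) + (∑ᶠ w ∈ {w : ℂ | w = 0 ∧ h₁ w = 0}, Literature.Topology.PlaneTopology.wind (fun t => h₁ (Literature.Topology.PlaneTopology.circleLoop w r t))) = 0 := by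
  intro h₀ h₁ hh₀ hh₁ h01 hfin
  -- the ambient `X = ℝ⁴`, the normal coordinate `π` and the fibre embedding `ι` (`π ∘ ι = id`)
  set π : EuclideanSpace ℝ (Fin 4) → ℂ := fun y => ⟨y 2, y 3⟩
  set ι : ℂ → EuclideanSpace ℝ (Fin 4) := fun c => !₂[(0 : ℝ), 0, c.re, c.im]
  have hπs : ContMDiffOn (𝓡 4) 𝓘(ℝ, ℂ) ∞ π univ :=
    contDiff_normalCoordinate.contMDiff.contMDiffOn
  have hcl : IsClosed {y : EuclideanSpace ℝ (Fin 4) | y ∈ (univ : Set _) ∧ π y = 0} := by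
    simp only [mem_univ, true_and]
    exact isClosed_eq contDiff_normalCoordinate.continuous continuous_const
  obtain ⟨c, hc⟩ := sphere_zeroSetIndex_factorsThroughHomology_of_isClosed
    (EuclideanSpace ℝ (Fin 4)) π univ isOpen_univ hπs hcl
  -- the two-chart sphere `(ι ∘ h₀, ι ∘ h₁)` and its glued map
  set u : ℂ → EuclideanSpace ℝ (Fin 4) := fun z => ι (h₀ z) with hudef
  set v : ℂ → EuclideanSpace ℝ (Fin 4) := fun w => ι (h₁ w) with hvdef
  have hπu : ∀ z, π (u z) = h₀ z := fun z => rfl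
  have hπv : ∀ w, π (v w) = h₁ w := fun w => rfl
  have hus : ContMDiff 𝓘(ℝ, ℂ) (𝓡 4) ∞ u := (contDiff_fibreEmbedding.comp hh₀).contMDiff
  have hvs : ContMDiff 𝓘(ℝ, ℂ) (𝓡 4) ∞ v := (contDiff_fibreEmbedding.comp hh₁).contMDiff
  have huv : ∀ z : ℂ, z ≠ 0 → v z = u z⁻¹ := by
    intro z hz
    simp only [hudef, hvdef, h01 z hz]
  obtain ⟨F, hF0, hF1⟩ := helper_gluedExists (EuclideanSpace ℝ (Fin 4)) u v hus.continuous
    hvs.continuous huv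
  -- the crossings with the plane `{π = 0}` are the zeros of `h₀`, `h₁`
  have hZ : {z : ℂ | u z ∈ (univ : Set _) ∧ π (u z) = 0} = {z : ℂ | h₀ z = 0} := by
    ext z
    simp only [mem_setOf_eq, mem_univ, true_and, hπu]
  have hZ' : {w : ℂ | w = 0 ∧ v w ∈ (univ : Set _) ∧ π (v w) = 0} = {w : ℂ | w = 0 ∧ h₁ w = 0} := by
    ext w
    simp only [mem_setOf_eq, mem_univ, true_and, hπv]
  have hfin' : {z : ℂ | u z ∈ (univ : Set _) ∧ π (u z) = 0}.Finite := by
    rw [hZ]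
    exact hfin
  obtain ⟨r₀, hr₀, hr⟩ := hc u v F hus hvs huv hF0 hF1 hfin'
  refine ⟨r₀, hr₀, fun r hr0 hrle => ?_⟩
  have key := hr r hr0 hrle
  -- the class of the sphere vanishes in `H₂(ℝ⁴; ℤ) = 0`
  rw [singularHomology_map_eq_zero_of_contractibleSpace F (by norm_num), hZ, hZ'] at key
  simp only [ModuleCat.hom_zero, LinearMap.zero_apply, map_zero, hπu, hπv] at key
  exact key.symm

end Summit.SmoothPoincare4.SmoothPoincare4.Theorems.GromovRecognitionRelEnd.CrossCapLaurent
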